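import Summits.Ventures.PercRepro.TriangleCapEightA

/-!
# PercRepro — the triangle cap at nullity `8`: `P(8) = 13`, PART B — the cone's closure (p3, gen 22)

For a point `x` on exactly three triangles `L₁ L₂ L₃`, the cone `C = L₁ ∪ L₂ ∪ L₃` has `7` points and rank `4`
(p2's `S1.cone_ncard_eRk`), its closure `H = cl C` has rank `4` and `≤ 10` points (C3), and a triangle with two
points in `H` lies in `H`. The triangles inside `H` are the triangles of the restriction `M ↾ H`, whose nullity is
`|H| − 4`, so p2's table bounds them: `≤ cq (|H| − 4)` (`ncard_triangles_subset_le_cq`).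

Axioms: standard.
-/

open scoped Matroid

namespace PercRepro

namespace TriangleCap

open Set

variable {α : Type}

/-- A triangle with two distinct points in a closed set `H = cl X` lies in `H`. -/
theorem triangle_subset_closure_of_two_mem (M : Matroid α) [M.Finite] {X : Set α} {T : Set α}
    (hT : T ∈ ThmN.triangles M) {a b : α} (ha : a ∈ T) (hb : b ∈ T) (hab : a ≠ b)
    (haH : a ∈ M.closure X) (hbH : b ∈ M.closure X) : T ⊆ M.closure X := by
  have h1 := S1.triangle_subset_closure_pair M hT ha hb hab
  have h2 : M.closure {a, b} ⊆ M.closure X := by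
    have : ({a, b} : Set α) ⊆ M.closure X := by
      intro z hz
      rcases hz with rfl | hz
      · exact haH
      · rw [Set.mem_singleton_iff] at hz; rw [hz]; exact hbH
    calc M.closure {a, b} ⊆ M.closure (M.closure X) := M.closure_subset_closure this
      _ = M.closure X := M.closure_closure X
  exact h1.trans h2

/-- The triangles of `M` inside `R ⊆ M.E` are the triangles of the restriction `M ↾ R`. -/
theorem triangles_restrict_eq (M : Matroid α) {R : Set α} (hR : R ⊆ M.E) :
    ThmN.triangles (M ↾ R) = {T ∈ ThmN.triangles M | T ⊆ R} := by
  ext T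
  simp only [ThmN.triangles, Set.mem_setOf_eq, _root_.Matroid.restrict_isCircuit_iff hR]
  tauto

/-- (C1)–(C3) pass to a restriction. -/
theorem flat_bounds_restrict (M : Matroid α) {R : Set α} (hR : R ⊆ M.E)
    (hC1 : ∀ L ⊆ M.E, M.eRk L = 2 → L.ncard ≤ 3) (hC2 : ∀ P ⊆ M.E, M.eRk P ≤ 3 → P.ncard ≤ 6)
    (hC3 : ∀ X ⊆ M.E, M.eRk X ≤ 4 → X.ncard ≤ 10) :
    (∀ L ⊆ (M ↾ R).E, (M ↾ R).eRk L = 2 → L.ncard ≤ 3) ∧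
    (∀ P ⊆ (M ↾ R).E, (M ↾ R).eRk P ≤ 3 → P.ncard ≤ 6) ∧
    (∀ X ⊆ (M ↾ R).E, (M ↾ R).eRk X ≤ 4 → X.ncard ≤ 10) := by
  refine ⟨?_, ?_, ?_⟩
  · intro L hL hr
    rw [_root_.Matroid.restrict_ground_eq] at hL
    rw [_root_.Matroid.restrict_eRk_eq M hL] at hr
    exact hC1 L (hL.trans hR) hr
  · intro P hP hr
    rw [_root_.Matroid.restrict_ground_eq] at hP
    rw [_root_.Matroid.restrict_eRk_eq M hP] at hr
    exact hC2 P (hP.trans hR) hr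
  · intro X hX hr
    rw [_root_.Matroid.restrict_ground_eq] at hX
    rw [_root_.Matroid.restrict_eRk_eq M hX] at hr
    exact hC3 X (hX.trans hR) hr

/-- **The triangles inside a set `R ⊆ M.E` of rank `r` with `|R| = r + d` number at most `cq d`** (p2's LEMMA Q
on the restriction `M ↾ R`). -/
theorem ncard_triangles_subset_le_cq (M : Matroid α) [M.Finite]
    (hC1 : ∀ L ⊆ M.E, M.eRk L = 2 → L.ncard ≤ 3) (hC2 : ∀ P ⊆ M.E, M.eRk P ≤ 3 → P.ncard ≤ 6)
    (hC3 : ∀ X ⊆ M.E, M.eRk X ≤ 4 → X.ncard ≤ 10) {R : Set α} (hR : R ⊆ M.E) {r d : ℕ}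
    (hr : M.eRk R = r) (hn : R.ncard = r + d) :
    {T ∈ ThmN.triangles M | T ⊆ R}.ncard ≤ S1.cq d := by
  haveI : (M ↾ R).Finite := _root_.Matroid.restrict_finite (M.ground_finite.subset hR)
  obtain ⟨h1, h2, h3⟩ := flat_bounds_restrict M hR hC1 hC2 hC3
  have hd : (M ↾ R).E.encard = (M ↾ R).eRank + (d : ℕ∞) := by
    rw [_root_.Matroid.restrict_ground_eq, _root_.Matroid.eRank_restrict, hr,
      ← (M.ground_finite.subset hR).cast_ncard_eq, hn]
    push_cast
    rfl
  have := S1.ncard_triangles_le_cq (M ↾ R) h1 h2 h3 hd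
  rwa [triangles_restrict_eq M hR] at this

end TriangleCap

end PercRepro
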